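import Summits.QuantumFields.YangMills.Theorems.ColdStartUniversalityLatticeLangevinMultivariateCLT
import Summits.QuantumFields.YangMills.Theorems.ColdStartUniversalityLatticeLangevinRegularFlow
import Mathlib.MeasureTheory.Measure.Portmanteau
import HarnessLib

/-!
# Route `ColdStartUniversality` (fixed-cut-off SZZ dynamics, sampler package): ★★★ THE DELTA METHOD — smooth functions of several time
# averages (ratios of Wilson loops, Creutz-type ratios, …) are asymptotically normal

Helper file (seat `ym-line-csu-p1`, g35; `--supports stmt-QuantumFields-24809`).  For every coupling, every realising kernel family, EVERY strong
solution `U` of the SU(2) SZZ dynamics from EVERY deterministic start, finitely many continuous observables `|Gᵢ| ≤ 1` with time averages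
`X̄_T = (T⁻¹∫₀^T Gᵢ(U_r)dr)ᵢ`, means `m = (μ_(β')Gᵢ)ᵢ` and Green–Kubo covariance matrix `S` (file 99b), and every measurable
`h : ℝ^ι → ℝ` Fréchet-differentiable at `m` with derivative `h'`:

  `√T_n (h(X̄_(T_n)) − h(m))  ⇒  h'(Y)`,  `Y ~ N(0, S)`   along every `T_n → ∞`   (★★★ `deltaMethod_timeAverage_clt`),

i.e. the limit is the centred Gaussian `N(0, h' S h'ᵀ)`.  Ingredients, both of independent use: convergence in distribution to a constant
implies convergence in probability (`tendstoInMeasure_of_tendstoInDistribution_const`, via the portmanteau theorem), and the first-order Taylor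
remainder of `h` at `m` evaluated at a sequence tending to `0` in probability tends to `0` in probability (`tendstoInMeasure_taylorRemainder`);
then Slutsky (Mathlib) twice and the multivariate CLT of file 99b; regular flow + pathwise uniqueness for arbitrary solutions.
THEOREMS ONLY, no definition, no sorry; [folklore] (Cramér 1946; van der Vaart, *Asymptotic Statistics*, Thm. 3.1).
HONEST FRAMING: fixed cut-off; `S` depends on `L, β'`; `UniformColdStartMixing` (24809) is NOT restated; no crux, rung or summit statement is
proved; the Yang–Mills mass gap is NOT proved.
-/

set_option autoImplicit false

noncomputable section

namespace Summit.QuantumFields.YangMills.Theorems.ColdStartUniversality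

open MeasureTheory ProbabilityTheory Filter Topology Set
open scoped NNReal ENNReal BigOperators
open Literature Literature.Probability.Process Literature.MathematicalPhysics.QuantumFieldTheory
open Literature.MathematicalPhysics.QuantumLattice (fundamentalRep fundamentalLatticeRep continuous_fundamentalRep)

/-! ## §1. Two general lemmas on convergence in probability -/

/-- Convergence in distribution to a constant implies convergence in probability to that constant (portmanteau: the closed set
`{‖y − c‖ ≥ ε}` has `δ_c`-null boundary). [folklore] -/
theorem tendstoInMeasure_of_tendstoInDistribution_const {ι Ω Ω' E : Type*} {mΩ : MeasurableSpace Ω} {mΩ' : MeasurableSpace Ω'}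
    {P : Measure Ω} [IsProbabilityMeasure P] {P' : Measure Ω'} [IsProbabilityMeasure P']
    [NormedAddCommGroup E] [MeasurableSpace E] [BorelSpace E] {l : Filter ι} {X : ι → Ω → E} {c : E}
    (h : TendstoInDistribution X l (fun _ => c) (fun _ => P) P') : TendstoInMeasure P X l (fun _ => c) := by
  rw [tendstoInMeasure_iff_norm]
  intro ε hε
  set B : Set E := {y | ε ≤ ‖y - c‖} with hB
  have hBc : IsClosed B := isClosed_le continuous_const (continuous_id.sub continuous_const).norm
  have hcB : c ∉ B := by simp [hB, hε]
  have hnull : ((P'.map fun _ : Ω' => c) : Measure E) (frontier B) = 0 := by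
    rw [Measure.map_apply measurable_const isClosed_frontier.measurableSet]
    have : (fun _ : Ω' => c) ⁻¹' frontier B = ∅ :=
      Set.eq_empty_of_forall_notMem fun ω hω => hcB (hBc.frontier_subset hω)
    rw [this, measure_empty]
  have key := ProbabilityMeasure.tendsto_measure_of_null_frontier_of_tendsto' h.tendsto (E := B) hnull
  have hlim : ((P'.map fun _ : Ω' => c) : Measure E) B = 0 := by
    rw [Measure.map_apply measurable_const hBc.measurableSet]
    have : (fun _ : Ω' => c) ⁻¹' B = ∅ := Set.eq_empty_of_forall_notMem fun ω hω => hcB hω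
    rw [this, measure_empty]
  simp only [ProbabilityMeasure.coe_mk] at key
  rw [hlim] at key
  exact key.congr fun i => by rw [Measure.map_apply_of_aemeasurable (h.forall_aemeasurable i) hBc.measurableSet]; rfl

/-- The first-order Taylor remainder in probability: if `h` is Fréchet-differentiable at `a` and `W_n → 0` in probability then
`(h(a + W_n) − h(a) − h'W_n)/‖W_n‖ → 0` in probability. [folklore] -/
theorem tendstoInMeasure_taylorRemainder {Ω E : Type*} {mΩ : MeasurableSpace Ω} {P : Measure Ω} [NormedAddCommGroup E] [NormedSpace ℝ E]
    {h : E → ℝ} {h' : E →L[ℝ] ℝ} {a : E} (hh : HasFDerivAt h h' a) {W : ℕ → Ω → E} (hW : TendstoInMeasure P W atTop fun _ => 0) :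
    TendstoInMeasure P (fun n ω => (h (a + W n ω) - h a - h' (W n ω)) / ‖W n ω‖) atTop fun _ => 0 := by
  rw [tendstoInMeasure_iff_norm] at hW ⊢
  intro ε hε
  have hlo := (hasFDerivAt_iff_isLittleO_nhds_zero.1 hh).def (half_pos hε)
  obtain ⟨δ, hδ, hδε⟩ := Metric.eventually_nhds_iff.1 hlo
  refine tendsto_of_tendsto_of_tendsto_of_le_of_le tendsto_const_nhds (hW δ hδ) (fun n => bot_le) fun n => measure_mono fun ω hω => ?_
  simp only [Set.mem_setOf_eq, sub_zero] at hω ⊢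
  by_contra hlt
  push Not at hlt
  have hb := hδε (by simpa [dist_eq_norm] using hlt)
  rw [norm_div, norm_norm] at hω
  rcases eq_or_ne ‖W n ω‖ 0 with h0 | h0
  · rw [h0, div_zero] at hω; linarith
  · have hpos : 0 < ‖W n ω‖ := lt_of_le_of_ne (norm_nonneg _) (Ne.symm h0)
    rw [le_div_iff₀ hpos] at hω
    have := mul_pos hε hpos
    linarith

/-! ## §2. The delta method for time averages of the cold-start sampler -/

variable {L : ℕ} [NeZero L]

/-- ★★★ **Delta method for the cold-start SZZ sampler.**  With `X̄_T = (T⁻¹∫₀^T Gᵢ(U_r)dr)ᵢ`, `m = (μ_(β')Gᵢ)ᵢ` and the Green–Kubo matrix `S` of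
file 99b: for every measurable `h : ℝ^ι → ℝ` Fréchet-differentiable at `m`, every strong solution from a deterministic start and every
`T_n → ∞` (`T_n > 0`), `√T_n (h(X̄_(T_n)) − h(m)) → h'(Y)` in distribution for every `Y ~ N(0, S)` (fixed cut-off). [folklore] -/
theorem deltaMethod_timeAverage_clt (L : ℕ) [NeZero L] (β' : ℝ)
    (κ : ℝ≥0 → Kernel (GaugeConfig 3 L (Matrix.specialUnitaryGroup (Fin 2) ℂ))
      (GaugeConfig 3 L (Matrix.specialUnitaryGroup (Fin 2) ℂ))) [∀ t, IsMarkovKernel (κ t)]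
    (hreal : ∀ (t : ℝ≥0) (x : GaugeConfig 3 L (Matrix.specialUnitaryGroup (Fin 2) ℂ))
        (Ω : Type) [MeasurableSpace Ω] (P : Measure Ω) [IsProbabilityMeasure P]
        (W : ℝ≥0 → Ω → (Edge 3 L × NoiseIdx 2 → ℝ)) (hW : IsFlatBrownian W P)
        (U : ℝ≥0 → Ω → GaugeConfig 3 L (Matrix.specialUnitaryGroup (Fin 2) ℂ)),
        (∀ ω, U 0 ω = x) →
        (latticeLangevinDynamics (fundamentalLatticeRep 2) β').IsSolution (fundamentalRep (Fin 2))
          hW.natFiltration P W U →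
        κ t x = P.map (U t))
    (x₀ : GaugeConfig 3 L (Matrix.specialUnitaryGroup (Fin 2) ℂ))
    {Ω : Type} [MeasurableSpace Ω] {P : Measure Ω} [IsProbabilityMeasure P]
    {W : ℝ≥0 → Ω → (Edge 3 L × NoiseIdx 2 → ℝ)} (hW : IsFlatBrownian W P)
    {U : ℝ≥0 → Ω → GaugeConfig 3 L (Matrix.specialUnitaryGroup (Fin 2) ℂ)} (hU0 : ∀ ω, U 0 ω = x₀)
    (hU : (latticeLangevinDynamics (fundamentalLatticeRep 2) β').IsSolution (fundamentalRep (Fin 2)) hW.natFiltration P W U)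
    {ι : Type} [Fintype ι] [DecidableEq ι]
    {G : ι → GaugeConfig 3 L (Matrix.specialUnitaryGroup (Fin 2) ℂ) → ℝ} (hGc : ∀ i, Continuous (G i)) (hG1 : ∀ i z, |G i z| ≤ 1)
    {S : Matrix ι ι ℝ}
    (hS : S = fun i j => ∫ t in Ioi (0 : ℝ),
      (∫ y, ((G i y - ∫ z, G i z ∂(wilsonMeasure (d := 3) (L := L) (fundamentalRep (Fin 2)) β')) *
          (∫ z, (G j z - ∫ z', G j z' ∂(wilsonMeasure (d := 3) (L := L) (fundamentalRep (Fin 2)) β')) ∂(κ t.toNNReal y)) +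
        (G j y - ∫ z, G j z ∂(wilsonMeasure (d := 3) (L := L) (fundamentalRep (Fin 2)) β')) *
          (∫ z, (G i z - ∫ z', G i z' ∂(wilsonMeasure (d := 3) (L := L) (fundamentalRep (Fin 2)) β')) ∂(κ t.toNNReal y)))
        ∂(wilsonMeasure (d := 3) (L := L) (fundamentalRep (Fin 2)) β')))
    {h : EuclideanSpace ℝ ι → ℝ} {h' : EuclideanSpace ℝ ι →L[ℝ] ℝ} (hhm : Measurable h)
    (hh : HasFDerivAt h h' (WithLp.toLp 2 fun i => ∫ z, G i z ∂(wilsonMeasure (d := 3) (L := L) (fundamentalRep (Fin 2)) β')))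
    (Ω' : Type) [MeasurableSpace Ω'] (P' : Measure Ω') [IsProbabilityMeasure P'] (Y : Ω' → EuclideanSpace ℝ ι)
    (hY : HasLaw Y (multivariateGaussian 0 S) P') (Tn : ℕ → ℝ) (hTn : Tendsto Tn atTop atTop) (hTpos : ∀ n, 0 < Tn n) :
    TendstoInDistribution (fun (n : ℕ) ω => Real.sqrt (Tn n) *
        (h (WithLp.toLp 2 fun i => (Tn n)⁻¹ * ∫ r in Ioc (0 : ℝ) (Tn n), G i (U r.toNNReal ω)) -
          h (WithLp.toLp 2 fun i => ∫ z, G i z ∂(wilsonMeasure (d := 3) (L := L) (fundamentalRep (Fin 2)) β'))))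
      atTop (fun ω' => h' (Y ω')) (fun _ => P) P' := by
  classical
  haveI := secondCountableTopology_su2
  haveI := borelSpace_config L
  set μ : Measure (GaugeConfig 3 L (Matrix.specialUnitaryGroup (Fin 2) ℂ)) :=
    wilsonMeasure (d := 3) (L := L) (fundamentalRep (Fin 2)) β' with hμ
  set m : ι → ℝ := fun i => ∫ z, G i z ∂μ with hm
  set mv : EuclideanSpace ℝ ι := WithLp.toLp 2 m with hmv
  /- ### 1. Regular flow and the multivariate CLT along it -/
  obtain ⟨V, -, hV, hVprog, -, -, -⟩ := exists_regularFlow L β' hW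
  have hprog : ∀ i : ℝ≥0, Measurable[@Prod.instMeasurableSpace (Set.Iic i) Ω inferInstance (hW.natFiltration i)]
      (fun q : Set.Iic i × Ω => V x₀ q.1 q.2) := fun i =>
    (hVprog i).comp (measurable_fst.prodMk (measurable_const.prodMk measurable_snd))
  have hae : ∀ᵐ ω ∂P, ∀ t, U t ω = V x₀ t ω := latticeLangevin_pathwise_unique hW β' x₀ hU0 (hV x₀).1 hU (hV x₀).2
  have hpathm : Measurable fun p : Ω × ℝ => V x₀ p.2.toNNReal p.1 :=
    measurable_uncurry_of_prog (Z := V x₀) (fun n : ℕ => hW.natFiltration n) (fun n => hW.natFiltration.le n) (fun n => hprog n)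
  have hpath : ∀ i ω (T : ℝ), IntegrableOn (fun r : ℝ => G i (V x₀ r.toNNReal ω)) (Ioc (0 : ℝ) T) volume := fun i ω T =>
    (integrableOn_const (C := (1 : ℝ)) (hs := measure_Ioc_lt_top.ne)).mono'
      (((hGc i).measurable.comp (hpathm.comp (measurable_const.prodMk measurable_id))).aestronglyMeasurable)
      (Eventually.of_forall fun r => by rw [Real.norm_eq_abs]; exact hG1 i _)
  have hIm : ∀ i (T : ℝ), Measurable fun ω => ∫ r in Ioc (0 : ℝ) T, G i (V x₀ r.toNNReal ω) := fun i T => by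
    have h1 : Measurable (Function.uncurry fun (ω : Ω) (r : ℝ) => G i (V x₀ r.toNNReal ω)) := (hGc i).measurable.comp hpathm
    exact (h1.stronglyMeasurable.integral_prod_right' (ν := volume.restrict (Ioc (0 : ℝ) T))).measurable
  have hclt := (multivariate_timeAverage_clt L β' κ hreal x₀ hW (hV x₀).1 (hV x₀).2 hGc hG1 hS).2 Ω' P' Y hY Tn hTn
  set Z : ℕ → Ω → EuclideanSpace ℝ ι := fun n ω => WithLp.toLp 2 fun i => (Real.sqrt (Tn n))⁻¹ *
    ∫ r in Ioc (0 : ℝ) (Tn n), (G i (V x₀ r.toNNReal ω) - m i) with hZ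
  have hZm : ∀ n, AEMeasurable (Z n) P := hclt.forall_aemeasurable
  /- ### 2. `W_n = T_n^(−1/2) Z_n → 0` in probability -/
  have hsq0 : Tendsto (fun n => (Real.sqrt (Tn n))⁻¹) atTop (𝓝 0) :=
    tendsto_inv_atTop_zero.comp (Real.tendsto_sqrt_atTop.comp hTn)
  have hdet : TendstoInMeasure P (fun n (_ : Ω) => (Real.sqrt (Tn n))⁻¹) atTop fun _ => (0 : ℝ) := by
    rw [tendstoInMeasure_iff_norm]
    intro ε hε
    have hev : ∀ᶠ n in atTop, ‖(Real.sqrt (Tn n))⁻¹ - 0‖ < ε :=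
      (tendsto_iff_norm_sub_tendsto_zero.1 hsq0).eventually (gt_mem_nhds hε)
    refine tendsto_const_nhds.congr' ?_
    filter_upwards [hev] with n hn
    rw [show {ω : Ω | ε ≤ ‖(Real.sqrt (Tn n))⁻¹ - 0‖} = ∅ from Set.eq_empty_of_forall_notMem fun ω hω => (not_le.2 hn) hω,
      measure_empty]
  set Wv : ℕ → Ω → EuclideanSpace ℝ ι := fun n ω => (Real.sqrt (Tn n))⁻¹ • Z n ω with hWv
  have hWm : ∀ n, AEMeasurable (Wv n) P := fun n =>
    (continuous_const_smul ((Real.sqrt (Tn n))⁻¹)).measurable.comp_aemeasurable (hZm n)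
  have hWd : TendstoInDistribution Wv atTop (fun ω' => (0 : ℝ) • Y ω') (fun _ => P) P' :=
    hclt.continuous_comp_prodMk_of_tendstoInMeasure_const (g := fun p : EuclideanSpace ℝ ι × ℝ => p.2 • p.1) (by fun_prop) hdet
      (fun n => aemeasurable_const)
  simp only [zero_smul] at hWd
  have hW0 : TendstoInMeasure P Wv atTop fun _ => (0 : EuclideanSpace ℝ ι) := tendstoInMeasure_of_tendstoInDistribution_const hWd
  /- ### 3. The Taylor remainder `ρ_n ‖Z_n‖ → 0` in probability -/
  set ρ : ℕ → Ω → ℝ := fun n ω => (h (mv + Wv n ω) - h mv - h' (Wv n ω)) / ‖Wv n ω‖ with hρ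
  have hρm : ∀ n, AEMeasurable (ρ n) P := fun n =>
    (((hhm.comp_aemeasurable ((hWm n).const_add mv)).sub aemeasurable_const).sub
      (h'.continuous.measurable.comp_aemeasurable (hWm n))).div (hWm n).norm
  have hρ0 : TendstoInMeasure P ρ atTop fun _ => (0 : ℝ) := tendstoInMeasure_taylorRemainder hh hW0
  have hDd : TendstoInDistribution (fun n ω => ρ n ω * ‖Z n ω‖) atTop (fun ω' => (0 : ℝ) * ‖Y ω'‖) (fun _ => P) P' :=
    hclt.continuous_comp_prodMk_of_tendstoInMeasure_const (g := fun p : EuclideanSpace ℝ ι × ℝ => p.2 * ‖p.1‖) (by fun_prop) hρ0 hρm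
  simp only [zero_mul] at hDd
  have hD0 : TendstoInMeasure P (fun n ω => ρ n ω * ‖Z n ω‖) atTop fun _ => (0 : ℝ) :=
    tendstoInMeasure_of_tendstoInDistribution_const hDd
  /- ### 4. The linear part converges; the statistic along `V` -/
  have hlin : TendstoInDistribution (fun n => ⇑h' ∘ Z n) atTop (⇑h' ∘ Y) (fun _ => P) P' := hclt.continuous_comp h'.continuous
  set Xb : ℕ → Ω → EuclideanSpace ℝ ι := fun n ω => WithLp.toLp 2 fun i => (Tn n)⁻¹ * ∫ r in Ioc (0 : ℝ) (Tn n), G i (V x₀ r.toNNReal ω)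
    with hXb
  have hXbm : ∀ n, Measurable (Xb n) := fun n =>
    (WithLp.measurable_toLp 2 _).comp (measurable_pi_lambda _ fun i => (hIm i _).const_mul _)
  set SV : ℕ → Ω → ℝ := fun n ω => Real.sqrt (Tn n) * (h (Xb n ω) - h mv) with hSV
  have hSVm : ∀ n, AEMeasurable (SV n) P := fun n => (((hhm.comp (hXbm n)).sub measurable_const).const_mul _).aemeasurable
  -- the algebraic identities at a fixed `n, ω`
  have hXW : ∀ n ω, Xb n ω = mv + Wv n ω := fun n ω => by
    have hT := hTpos n
    have hsq : Real.sqrt (Tn n) * Real.sqrt (Tn n) = Tn n := Real.mul_self_sqrt hT.le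
    simp only [hXb, hWv, hZ, hmv, ← WithLp.toLp_smul, ← WithLp.toLp_add]
    congr 1
    funext i
    simp only [Pi.add_apply, Pi.smul_apply, smul_eq_mul]
    rw [integral_sub (hpath i ω _) (integrableOn_const (hs := measure_Ioc_lt_top.ne)), setIntegral_const,
      Real.volume_real_Ioc_of_le hT.le, sub_zero, smul_eq_mul, ← mul_assoc, ← mul_inv, hsq]
    field_simp
    ring
  have hZW : ∀ n ω, Z n ω = Real.sqrt (Tn n) • Wv n ω := fun n ω => by
    simp only [hWv, smul_smul]
    rw [mul_inv_cancel₀ (Real.sqrt_pos.2 (hTpos n)).ne', one_smul]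
  have hid : ∀ n ω, SV n ω - h' (Z n ω) = ρ n ω * ‖Z n ω‖ := fun n ω => by
    have hs0 : 0 ≤ Real.sqrt (Tn n) := Real.sqrt_nonneg _
    have hnZ : ‖Z n ω‖ = Real.sqrt (Tn n) * ‖Wv n ω‖ := by rw [hZW, norm_smul, Real.norm_eq_abs, abs_of_nonneg hs0]
    simp only [hSV, hρ]
    rw [hXW, hnZ, hZW, map_smul, smul_eq_mul]
    rcases eq_or_ne ‖Wv n ω‖ 0 with h0 | h0
    · have hW0' : Wv n ω = 0 := norm_eq_zero.1 h0
      simp [hW0']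
    · field_simp
  have hsub : TendstoInMeasure P (SV - fun n => ⇑h' ∘ Z n) atTop 0 :=
    hD0.congr (fun n => Eventually.of_forall fun ω => (hid n ω).symm) (ae_eq_refl _)
  have hSVd : TendstoInDistribution SV atTop (⇑h' ∘ Y) (fun _ => P) P' :=
    tendstoInDistribution_of_tendstoInMeasure_sub SV (⇑h' ∘ Y) hlin hsub hSVm
  /- ### 5. Transfer to `U` -/
  have hSU : ∀ n, SV n =ᵐ[P] fun ω => Real.sqrt (Tn n) *
      (h (WithLp.toLp 2 fun i => (Tn n)⁻¹ * ∫ r in Ioc (0 : ℝ) (Tn n), G i (U r.toNNReal ω)) - h mv) := fun n => by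
    filter_upwards [hae] with ω hω
    simp only [hSV, hXb]
    congr 4
    funext i
    have : (fun r : ℝ => G i (U r.toNNReal ω)) = fun r : ℝ => G i (V x₀ r.toNNReal ω) := funext fun r => by rw [hω]
    rw [this]
  exact hSVd.congr hSU (ae_eq_refl _)

end Summit.QuantumFields.YangMills.Theorems.ColdStartUniversality

end
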